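import Summits.ResolutionOfSingularities.ResolutionOfSingularities.Theorems.EquisingularLiftEquisingularLiftNatClusterLiftStrictTransformSquarefree
import Mathlib
import HarnessLib

/-!
# [OURS · L1 W4.5(b)] T-CLUSTER-LIFT part 11 — the TANGENT WITNESS: a member of the cluster system with initial form `U_p^{m}` at a
# sectioned point has strict transform `≡ 1 (mod X_p)` on the `p`-chart, hence avoids EVERY bad prime on the exceptional line; and
# subspace avoidance in the cluster system for arbitrary linear conditions (crux `EquisingularLiftNat` = stmt-ResolutionOfSingularities-20038; v7′)

NOT a statement of any manuscript. Helper file of the chain res-L1-w45b (cell `res-hironaka`, LADDER-RESOLUTION rung L, slot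
W4.5(b)); OURS; AI-written, weaker than expert review; `--supports stmt-ResolutionOfSingularities-20038 --as helper` by
res-L1-w45b-stub-3 (T-CLUSTER-LIFT part 11; res-L1-w45b-stub-4 DESIGN NOTE 2026-08-27T13:00:53Z / res-L1-w45b-lead-2 RULING 13:05:02Z:
the downstairs TANGENT-WITNESS clause `ClusterTangentWitness` of CLUSTERSTEP v3 and its upstairs use). No `sorry`; standard axioms.

WHAT. Part 9's cone theorem (`…_stCharts`, p531761) asks, on each strict-transform chart `(t, p)`, for a witness `M̄` in the cluster system
whose strict transform `Mst t p` avoids the bad primes of `gst t p` off `E' t p`. res-L1-w45b-stub-4 observed that for HEAVY clusters the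
system is `span{g}` and no witness exists at the INFINITELY-NEAR bad points (primes `𝔮 ∋ X_p` on the exceptional line): the v1 clause (b)
controls jets of order `< m_t` only, not the initial form. With the v3 clause (b′) «the cluster fattened by one at the single point `t` is
still non-superabundant» the initial form at `a_t` can be PRESCRIBED, and the prescription `U_p^{m_t}` settles every such prime at once:

* `divMonomial_blowupSubst_sub_one_mem_of_jet` — if `F ∈ k[U]` has all coefficients of degree `≤ m` equal to those of `U_p^m`
  (`F − U_p^m ∈ (U)^{m+1}`), then `(β_p F) /ᵐᵒⁿ X_p^m − 1 ∈ (X_p)`: the strict transform is `≡ 1` on the exceptional line;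
* `notMem_of_sub_one_mem_span_X` — hence it lies in NO proper ideal containing `X_p` (every bad prime over the sectioned point);
* **`exists_clusterForm_stChart_sub_one_mem`** — from the TANGENT WITNESS at `t` (jets of order `≤ m_t` at `a_t` and `< m_{t'}` elsewhere
  jointly prescribable: the `hind`-shape hypothesis with `Function.update m t (m t + 1)`), a form `M̄ ∈ k[T_σ]_{dg}` of order `≥ m_{t'}` at every
  cluster point whose strict transform on the chart `p` over `a_t` is `≡ 1 (mod X_p)`;
* **`exists_clusterForm_forall_linear_notMem`** — SUBSPACE AVOIDANCE in the cluster system for an arbitrary finite family of `k`-LINEAR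
  condition maps `L_s` into modules `W_s` with forbidden submodules `N_s` (part 8's `exists_clusterForm_forall_dehomogenize_notMem` is the case
  `L_s = dehomogenize j_s`, `N_s = 𝔮_s`); the strict-transform charts `st = (β_p ∘ sh_a ∘ dehomogenize i_t)(·) /ᵐᵒⁿ X_p^m` are such maps (part 9),
  so ONE witness serving the standard charts, the sets `E`, `E'` and the exceptional lines exists as soon as each condition has its own
  witness — which (b) (COVER points: «value 1 at q») and (b′) (exceptional lines: this file) provide.

References: parts 1, 8, 9, 10; res-L1-w45b-stub-4 p525038 (`β_p`); Mathlib `Submodule.exists_forall_notMem_of_forall_ne_top`,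
`MvPolynomial.divMonomial`. res-L1-w45b-stub-4 DESIGN NOTE / res-L1-w45b-lead-2 RULING (OURS planning texts, index only).
-/

set_option linter.dupNamespace false -- mandated namespace `Summit.<Summit>.<Problem>` of this single-conjunct summit

noncomputable section

open MvPolynomial IsLocalRing Literature.AlgebraicGeometry.Resolution
open Summit.ResolutionOfSingularities.ResolutionOfSingularities.Theorems
open Summit.ResolutionOfSingularities.ResolutionOfSingularities.Theorems.EquisingularLiftNat.ClusterLift

namespace Summit.ResolutionOfSingularities.ResolutionOfSingularities.Cruxes.EquisingularLiftNat.Sections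

universe u

/-! ## Initial form `U_p^m` ⇒ strict transform `≡ 1 (mod X_p)` -/

section InitialForm

variable {R : Type*} [CommRing R] {τ : Type*} [DecidableEq τ] (p : τ)

/-- **Initial form `U_p^m` ⇒ strict transform `≡ 1` on the exceptional line.** If `F − U_p^m ∈ (U)^{m+1}` (the jet of order `≤ m` of `F`
at the origin is that of `U_p^m`), then `(β_p F) /ᵐᵒⁿ X_p^m − 1 ∈ (X_p)`. [folklore] [OURS · L1 W4.5b] -/
theorem divMonomial_blowupSubst_sub_one_mem_of_jet {m : ℕ} {F : MvPolynomial τ R}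
    (hF : F - X p ^ m ∈ idealOfVars τ R ^ (m + 1)) :
    (aeval (fun j => if j = p then (X p : MvPolynomial τ R) else X p * X j) F).divMonomial (Finsupp.single p m) - 1 ∈
      Ideal.span {(X p : MvPolynomial τ R)} := by
  -- `β_p F = X_p^m + β_p (F − U_p^m)` with `β_p (F − U_p^m) ∈ (X_p^{m+1}) = X_p^m · (X_p)`
  have hrest := aeval_blowupSubst_mem_span_X_pow p hF
  obtain ⟨G, hG⟩ := Ideal.mem_span_singleton'.mp hrest
  have hβ : aeval (fun j => if j = p then (X p : MvPolynomial τ R) else X p * X j) F =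
      monomial (Finsupp.single p m) 1 * (1 + X p * G) := by
    have h1 : aeval (fun j => if j = p then (X p : MvPolynomial τ R) else X p * X j) F =
        X p ^ m + aeval (fun j => if j = p then (X p : MvPolynomial τ R) else X p * X j) (F - X p ^ m) := by
      rw [map_sub, map_pow, aeval_X, if_pos rfl, add_sub_cancel]
    rw [h1, ← hG, ← X_pow_eq_monomial, pow_succ]
    ring
  rw [hβ, divMonomial_monomial_mul, add_sub_cancel_left]
  exact Ideal.mul_mem_right _ _ (Ideal.mem_span_singleton_self _)

omit [DecidableEq τ] in
/-- An element `≡ 1 (mod X_p)` lies in no proper ideal containing `X_p`. [folklore] -/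
theorem notMem_of_sub_one_mem_span_X {st : MvPolynomial τ R} (hst : st - 1 ∈ Ideal.span {(X p : MvPolynomial τ R)})
    {𝔮 : Ideal (MvPolynomial τ R)} (h𝔮 : 𝔮 ≠ ⊤) (hX : (X p : MvPolynomial τ R) ∈ 𝔮) : st ∉ 𝔮 := by
  intro hmem
  apply h𝔮
  rw [Ideal.eq_top_iff_one]
  have h1 : st - (st - 1) = 1 := sub_sub_cancel st 1
  rw [← h1]
  exact Ideal.sub_mem _ hmem ((Ideal.span_singleton_le_iff_mem _).mpr hX hst)

end InitialForm

/-! ## The tangent witness: a member of the cluster system with initial form `U_p^{m_t}` at `a_t` -/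

section Witness

variable {k : Type*} [Field k] {σ : Type*} [DecidableEq σ] {ι : Type*} [DecidableEq ι]

/-- **THE TANGENT WITNESS.** Cluster `(i, a, m)`; at the point `t`, assume the jets of order `≤ m t` at `a t` together with the jets of order
`< m t'` at the other points are jointly realisable by forms of degree `dg` (the v3 clause (b′) `ClusterTangentWitness` at `t`: part 1's
`hind` for the orders `Function.update m t (m t + 1)`). Then there is a form `M̄ ∈ k[T_σ]_{dg}` of order `≥ m t'` at EVERY cluster point
(a member of the cluster system) whose strict transform on the chart `p` over `a t`, `Mst = (β_p (M̄(T_{i t} := 1)(X + a t))) /ᵐᵒⁿ X_p^{m t}`,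
satisfies `Mst − 1 ∈ (X_p)` — so `Mst ∉ 𝔮` for every proper ideal `𝔮 ∋ X_p` (`notMem_of_sub_one_mem_span_X`): the witness demanded by
part 9's `hMstavoid` at the INFINITELY-NEAR bad points, whatever they are. [OURS · L1 W4.5b] -/
theorem exists_clusterForm_stChart_sub_one_mem (i : ι → σ) (a : (t : ι) → {j : σ // j ≠ i t} → k) (m : ι → ℕ)
    {dg : ℕ} (t : ι) (p : {j : σ // j ≠ i t})
    (htw : ∀ v : (t' : ι) → ({j : σ // j ≠ i t'} →₀ ℕ) → k, ∃ g' : MvPolynomial σ k, g'.IsHomogeneous dg ∧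
      ∀ t' α, α.degree < Function.update m t (m t + 1) t' →
        coeff α (aeval (fun j => (X j : MvPolynomial {j : σ // j ≠ i t'} k) + C (a t' j)) (dehomogenize (i t') g')) = v t' α) :
    ∃ M : MvPolynomial σ k, M.IsHomogeneous dg ∧
      (∀ t', dehomogenize (i t') M ∈
        (Ideal.span (Set.range fun j => (X j : MvPolynomial {j : σ // j ≠ i t'} k) - C (a t' j))) ^ m t') ∧
      (aeval (fun j => if j = p then (X p : MvPolynomial {j : σ // j ≠ i t} k) else X p * X j)
          (aeval (fun l => (X l : MvPolynomial {j : σ // j ≠ i t} k) + C (a t l)) (dehomogenize (i t) M))).divMonomial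
        (Finsupp.single p (m t)) - 1 ∈ Ideal.span {(X p : MvPolynomial {j : σ // j ≠ i t} k)} := by
  classical
  -- prescribe: at `t` the jet of `U_p^{m t}`, elsewhere zero
  obtain ⟨M, hM, hjet⟩ := htw fun t' α =>
    if ht : t' = t then (if α = (ht ▸ Finsupp.single p (m t) : {j : σ // j ≠ i t'} →₀ ℕ) then 1 else 0) else 0
  refine ⟨M, hM, fun t' => ?_, ?_⟩
  · -- order ≥ m t' everywhere
    rw [mem_pow_span_X_sub_C_iff]
    intro α hα
    by_cases ht : t' = t
    · subst ht
      have hlt : α.degree < Function.update m t' (m t' + 1) t' := by rw [Function.update_self]; omega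
      rw [hjet t' α hlt, dif_pos rfl, if_neg]
      intro hαeq
      rw [hαeq, Finsupp.degree_single] at hα
      exact lt_irrefl _ hα
    · have hlt : α.degree < Function.update m t (m t + 1) t' := by rw [Function.update_of_ne ht]; exact hα
      rw [hjet t' α hlt, dif_neg ht]
  · -- the jet at `t` is that of `U_p^{m t}`
    refine divMonomial_blowupSubst_sub_one_mem_of_jet p ?_
    rw [mem_pow_idealOfVars_iff']
    intro α hα
    have hlt : α.degree < Function.update m t (m t + 1) t := by rw [Function.update_self]; omega
    rw [coeff_sub, hjet t α hlt, dif_pos rfl, X_pow_eq_monomial, coeff_monomial]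
    by_cases hαeq : α = Finsupp.single p (m t)
    · subst hαeq; simp
    · rw [if_neg hαeq, if_neg (Ne.symm hαeq), sub_zero]

end Witness

/-! ## Subspace avoidance in the cluster system, arbitrary linear conditions -/

section Avoid

variable {k : Type*} [Field k] [Infinite k] {σ : Type*} [DecidableEq σ] {ι : Type*} (i : ι → σ)

/-- **Subspace avoidance in the cluster system, linear conditions.** `k` infinite; cluster `(i, a, m)`; finitely many conditions `s`, each
given by a `k`-linear map `L_s : k[T_σ] → W_s` and a forbidden submodule `N_s ⊆ W_s`. If every condition has a witness in the degree-`d`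
cluster system (`L_s w ∉ N_s`), then ONE form of the system satisfies them all. (Part 8's `exists_clusterForm_forall_dehomogenize_notMem`
is the case `L_s := dehomogenize j_s`, `N_s := 𝔮_s`; part 9's strict-transform charts `st` are such `L_s`.) [folklore] [OURS · L1 W4.5b] -/
theorem exists_clusterForm_forall_linear_notMem (a : (t : ι) → {j : σ // j ≠ i t} → k) (m : ι → ℕ) (d : ℕ)
    {S : Type*} [Finite S] {W : S → Type*} [∀ s, AddCommGroup (W s)] [∀ s, Module k (W s)]
    (L : (s : S) → MvPolynomial σ k →ₗ[k] W s) (N : (s : S) → Submodule k (W s))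
    (hwit : ∀ s, ∃ w : MvPolynomial σ k, w.IsHomogeneous d ∧
      (∀ t, dehomogenize (i t) w ∈
        (Ideal.span (Set.range fun l => (X l : MvPolynomial {l : σ // l ≠ i t} k) - C (a t l))) ^ m t) ∧
      L s w ∉ N s) :
    ∃ M : MvPolynomial σ k, M.IsHomogeneous d ∧
      (∀ t, dehomogenize (i t) M ∈
        (Ideal.span (Set.range fun l => (X l : MvPolynomial {l : σ // l ≠ i t} k) - C (a t l))) ^ m t) ∧
      ∀ s, L s M ∉ N s := by
  let V : Submodule k (MvPolynomial σ k) := homogeneousSubmodule σ k d ⊓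
    ⨅ t, Submodule.comap (dehomogenize (i t)).toLinearMap
      (((Ideal.span (Set.range fun l => (X l : MvPolynomial {l : σ // l ≠ i t} k) - C (a t l))) ^ m t).restrictScalars k)
  have hV : ∀ w : MvPolynomial σ k, w ∈ V ↔ w.IsHomogeneous d ∧ ∀ t, dehomogenize (i t) w ∈
      (Ideal.span (Set.range fun l => (X l : MvPolynomial {l : σ // l ≠ i t} k) - C (a t l))) ^ m t := by
    intro w
    simp only [V, Submodule.mem_inf, mem_homogeneousSubmodule, Submodule.mem_iInf, Submodule.mem_comap,
      AlgHom.toLinearMap_apply, Submodule.restrictScalars_mem]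
  let P : S → Submodule k V := fun s => (N s).comap (L s ∘ₗ V.subtype)
  have hP : ∀ s, P s ≠ ⊤ := by
    intro s hs
    obtain ⟨w, hw, hwZ, hwN⟩ := hwit s
    have hmem : (⟨w, (hV w).mpr ⟨hw, hwZ⟩⟩ : V) ∈ P s := by rw [hs]; exact Submodule.mem_top
    exact hwN hmem
  obtain ⟨x, hx⟩ := Submodule.exists_forall_notMem_of_forall_ne_top P hP
  obtain ⟨hx1, hx2⟩ := (hV x.1).mp x.2
  exact ⟨x.1, hx1, hx2, fun s hs => hx s hs⟩

end Avoid

end Summit.ResolutionOfSingularities.ResolutionOfSingularities.Cruxes.EquisingularLiftNat.Sections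

end
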